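import Summits.CriticalPhenomena.PercolationContinuityZ3.Theorems.PercNearOneGluingNoHeavyLowerTailUpsetExchangeGap
import Summits.CriticalPhenomena.PercolationContinuityZ3.Theorems.PercNearOneGluingNoHeavyLowerTailTwoFormalUnits
import HarnessLib

/-!
# `NoHeavyLowerTail` (stmt-CriticalPhenomena-4575) — the NO-ALL-BAD lemma and the unconditional two-formal-units
# inequality (corner `C₀₀` of the `2+2` kernel)

Support file (lemma factory `prim-lf-3` gen 7, seat g9; `--supports stmt-CriticalPhenomena-4575`).  No definitions, no
named facts, no sorries.  Memo: `run/shared/lean/prim/prim-lf-3/LF3-BETA-R.md` §4.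

Setting as in `…TwoFormalUnits.lean`: core weights `w`, pairs `e_P = s(p₁,p₂)`, `e_Q = s(q₁,q₂)`, `wP := w[e_P ↦ 1]`, `wQ := w[e_Q ↦ 1]`.
A `p`-port is GOOD if `μ_{wQ}(p ↔ b) ≤ μ_{wQ}(q₁ ↔ b)` (it does not beat the glued pair `Q`), a `q`-port if `μ_{wP}(q ↔ b) ≤ μ_{wP}(p₁ ↔ b)`.

* `goodPort_exists` — some port is good.  If all four were strictly bad, the gap form of Lemma 5 (`pairGlue_gap`) applied in `wQ`
  (glue `e_P`, reference `p₁`, loser `q₁`) and in `wP` (glue `e_Q`, reference `q₁`, loser `p₁`) gives, in the doubly glued weighting,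
  `(g₁ + g₃)·μ(p₁ ↮ q₁) ≤ 0`, so `p₁ ↔ q₁` a.s. there, i.e. `μ_{wQ}(p₁ ↮ q₁, p₂ ↮ q₁) = 0`; Harris for the two decreasing events makes
  one of them null, and a port a.s. joined to `q₁` cannot strictly beat it.
* `twoFormalUnits` — `twoFormalUnits_core` with its case hypothesis discharged by `goodPort_exists`:
  under the four split rows and the two far-end rows, `u(1−v)·α_P + (1−u)v·α_Q + uv·δ ≥ 0`.
-/

namespace Summit.CriticalPhenomena.PercolationContinuityZ3.Theorems

open MeasureTheory Set ProbabilityTheory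
open Literature.Probability.LatticeModels
open Literature.Probability.Percolation

noncomputable section
open Classical

namespace UpsetExchange

variable {n : ℕ}

/-- A vertex a.s. joined to `c` is at most as connected to `b` as `c` — quantitatively
`μ(x ↔ b) ≤ μ(c ↔ b) + μ(x ↮ c)`. [folklore] -/
theorem real_openConn_le_add_notConn (g : Sym2 (Fin n) → unitInterval) (x c b : Fin n) :
    (prodBernoulli g).real (openConn x b) ≤ (prodBernoulli g).real (openConn c b) +
      (prodBernoulli g).real (openConn x c)ᶜ := by
  have hsub : (openConn x b : Set (BondConfig (Fin n))) ⊆ openConn c b ∪ (openConn x c)ᶜ := by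
    intro ω hxb
    by_cases hxc : ω ∈ (openConn x c : Set (BondConfig (Fin n)))
    · exact Or.inl ((hxc : (openGraph ω).Reachable x c).symm.trans (hxb : (openGraph ω).Reachable x b))
    · exact Or.inr hxc
  exact (measureReal_mono hsub (measure_ne_top _ _)).trans (measureReal_union_le _ _)

/-- **No-all-bad lemma.**  See the module docstring. [cite: KozmaNitzan2024, Lemma 5 (p. 13); VandenbergHaggstromKahn2005, Thm. 1.2] -/
theorem goodPort_exists (w : Sym2 (Fin n) → unitInterval) (p₁ p₂ q₁ q₂ b : Fin n)
    (hp : p₁ ≠ p₂) (hq : q₁ ≠ q₂) :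
    (∃ z ∈ ({p₁, p₂} : Finset (Fin n)),
        (prodBernoulli (fun f : Sym2 (Fin n) => if f = s(q₁, q₂) then 1 else w f)).real (openConn z b) ≤
          (prodBernoulli (fun f : Sym2 (Fin n) => if f = s(q₁, q₂) then 1 else w f)).real (openConn q₁ b)) ∨
      (∃ z ∈ ({q₁, q₂} : Finset (Fin n)),
        (prodBernoulli (fun f : Sym2 (Fin n) => if f = s(p₁, p₂) then 1 else w f)).real (openConn z b) ≤
          (prodBernoulli (fun f : Sym2 (Fin n) => if f = s(p₁, p₂) then 1 else w f)).real (openConn p₁ b)) := by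
  set wP : Sym2 (Fin n) → unitInterval := fun f => if f = s(p₁, p₂) then 1 else w f with hwP
  set wQ : Sym2 (Fin n) → unitInterval := fun f => if f = s(q₁, q₂) then 1 else w f with hwQ
  by_contra hcon
  rw [not_or] at hcon
  obtain ⟨h1, h2⟩ := hcon
  simp only [not_exists, not_and, not_le] at h1 h2
  have b1 := h1 p₁ (by simp)
  have b2 := h1 p₂ (by simp)
  have b3 := h2 q₁ (by simp)
  -- the doubly glued weighting
  set wPQ : Sym2 (Fin n) → unitInterval := fun f => if f = s(p₁, p₂) then 1 else wQ f with hwPQ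
  have hwQP : (fun f : Sym2 (Fin n) => if f = s(q₁, q₂) then (1 : unitInterval) else wP f) = wPQ := by
    funext f
    simp only [hwPQ, hwP, hwQ]
    by_cases c1 : f = s(q₁, q₂)
    · rw [if_pos c1]
      by_cases c2 : f = s(p₁, p₂)
      · rw [if_pos c2]
      · rw [if_neg c2, if_pos c1]
    · rw [if_neg c1]
      by_cases c2 : f = s(p₁, p₂)
      · rw [if_pos c2, if_pos c2]
      · rw [if_neg c2, if_neg c2, if_neg c1]
  -- gap Lemma 5 twice
  set g₁ : ℝ := (prodBernoulli wQ).real (openConn p₁ b) - (prodBernoulli wQ).real (openConn q₁ b) with hg₁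
  set g₃ : ℝ := (prodBernoulli wP).real (openConn q₁ b) - (prodBernoulli wP).real (openConn p₁ b) with hg₃
  have hg₁pos : 0 < g₁ := by rw [hg₁]; linarith
  have hg₃pos : 0 < g₃ := by rw [hg₃]; linarith
  have x1 := pairGlue_gap wQ hp q₁ b (le_of_lt hg₁pos) (by rw [hg₁]; linarith)
  have x2 := pairGlue_gap wP hq p₁ b (le_of_lt hg₃pos) (by rw [hg₃]; linarith)
  rw [hwQP] at x2
  change (prodBernoulli wPQ).real (openConn q₁ b) + g₁ * (prodBernoulli wPQ).real (openConn q₁ p₁)ᶜ ≤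
    (prodBernoulli wPQ).real (openConn p₁ b) at x1
  have hsym : (openConn q₁ p₁ : Set (BondConfig (Fin n))) = openConn p₁ q₁ :=
    Set.ext fun _ => ⟨fun h => SimpleGraph.Reachable.symm h, fun h => SimpleGraph.Reachable.symm h⟩
  rw [hsym] at x1
  have hN0 : (prodBernoulli wPQ).real (openConn p₁ q₁)ᶜ = 0 := by
    have hN : 0 ≤ (prodBernoulli wPQ).real (openConn p₁ q₁)ᶜ := measureReal_nonneg
    nlinarith
  -- read it in `wQ`: `μ_{wQ}(p₁ ↮ q₁ ∧ p₂ ↮ q₁) = 0`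
  have hpush : (prodBernoulli wPQ).real (openConn p₁ q₁)ᶜ =
      (prodBernoulli wQ).real ((openConn p₁ q₁)ᶜ ∩ (openConn p₂ q₁)ᶜ) := by
    rw [glueSet_pushforward wQ wPQ {s(p₁, p₂)} (fun f hf => by rw [mem_singleton_iff.1 hf]; simp [hwPQ])
      (fun f hf => by
        have hf' : f ≠ s(p₁, p₂) := fun h => hf (h ▸ mem_singleton _)
        simp [hwPQ, hf'])]
    congr 1
    ext ω
    simp only [mem_setOf_eq, mem_compl_iff, mem_inter_iff]
    constructor
    · intro h
      constructor
      · exact fun h1 => h (WeakestPort.reachable_union_pair_of hp (Or.inl h1))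
      · exact fun h2 => h (WeakestPort.reachable_union_pair_of hp (Or.inr (Or.inl ⟨SimpleGraph.Reachable.refl _, h2⟩)))
    · rintro ⟨h1, h2⟩ h
      rcases WeakestPort.reachable_union_pair (x := p₁) (y := p₂) (h : (openGraph _).Reachable p₁ q₁) with k | ⟨-, k⟩ | ⟨-, k⟩
      · exact h1 k
      · exact h2 k
      · exact h1 k
  rw [hpush] at hN0
  -- Harris for the two decreasing events
  have hl1 : IsLowerSet ((openConn p₁ q₁)ᶜ : Set (BondConfig (Fin n))) := (isUpperSet_openConn p₁ q₁).compl
  have hl2 : IsLowerSet ((openConn p₂ q₁)ᶜ : Set (BondConfig (Fin n))) := (isUpperSet_openConn p₂ q₁).compl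
  have hH := Literature.Probability.LatticeModels.prodBernoulli_harris_lower wQ hl1 hl2
    MeasurableSet.of_discrete MeasurableSet.of_discrete
  rw [hN0] at hH
  have hA : 0 ≤ (prodBernoulli wQ).real (openConn p₁ q₁)ᶜ := measureReal_nonneg
  have hB : 0 ≤ (prodBernoulli wQ).real (openConn p₂ q₁)ᶜ := measureReal_nonneg
  have hzero : (prodBernoulli wQ).real (openConn p₁ q₁)ᶜ = 0 ∨ (prodBernoulli wQ).real (openConn p₂ q₁)ᶜ = 0 := by
    rcases mul_eq_zero.1 (le_antisymm hH (mul_nonneg hA hB)) with h | h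
    · exact Or.inl h
    · exact Or.inr h
  rcases hzero with h | h
  · have := real_openConn_le_add_notConn wQ p₁ q₁ b
    linarith
  · have := real_openConn_le_add_notConn wQ p₂ q₁ b
    linarith

/-- **Two formal units, unconditional** (corner `C₀₀` of the `2+2` kernel): `twoFormalUnits_core` with the case hypothesis
discharged by `goodPort_exists`. [cite: KozmaNitzan2024, Question 9 (p. 36), Lemma 5, Lemma 3(i)] -/
theorem twoFormalUnits (w : Sym2 (Fin n) → unitInterval) (p₁ p₂ q₁ q₂ j b : Fin n)
    (hp : p₁ ≠ p₂) (hq : q₁ ≠ q₂) (hpq : p₁ ≠ q₁)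
    {u v : ℝ} (hu0 : 0 ≤ u) (hu1 : u ≤ 1) (hv0 : 0 ≤ v) (hv1 : v ≤ 1)
    (hMP : 0 ≤ (1 - v) * ((prodBernoulli (fun f : Sym2 (Fin n) => if f = s(p₁, p₂) then 1 else w f)).real (openConn p₁ b) -
        (prodBernoulli (fun f : Sym2 (Fin n) => if f = s(p₁, p₂) then 1 else w f)).real (openConn j b)) +
      v * ((prodBernoulli (fun f : Sym2 (Fin n) => if f = s(p₁, p₂) then 1 else if f = s(q₁, q₂) then 1 else w f)).real (openConn p₁ b) -
        (prodBernoulli (fun f : Sym2 (Fin n) => if f = s(p₁, p₂) then 1 else if f = s(q₁, q₂) then 1 else w f)).real (openConn j b)))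
    (hMQ : 0 ≤ (1 - u) * ((prodBernoulli (fun f : Sym2 (Fin n) => if f = s(q₁, q₂) then 1 else w f)).real (openConn q₁ b) -
        (prodBernoulli (fun f : Sym2 (Fin n) => if f = s(q₁, q₂) then 1 else w f)).real (openConn j b)) +
      u * ((prodBernoulli (fun f : Sym2 (Fin n) => if f = s(p₁, p₂) then 1 else if f = s(q₁, q₂) then 1 else w f)).real (openConn q₁ b) -
        (prodBernoulli (fun f : Sym2 (Fin n) => if f = s(p₁, p₂) then 1 else if f = s(q₁, q₂) then 1 else w f)).real (openConn j b)))
    (hrow : ∀ z ∈ ({p₁, p₂, q₁, q₂} : Finset (Fin n)), 0 ≤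
      (1 - u) * (1 - v) * ((prodBernoulli w).real (openConn z b) - (prodBernoulli w).real (openConn j b)) +
      u * (1 - v) * ((prodBernoulli (fun f : Sym2 (Fin n) => if f = s(p₁, p₂) then 1 else w f)).real (openConn z b) -
        (prodBernoulli (fun f : Sym2 (Fin n) => if f = s(p₁, p₂) then 1 else w f)).real (openConn j b)) +
      (1 - u) * v * ((prodBernoulli (fun f : Sym2 (Fin n) => if f = s(q₁, q₂) then 1 else w f)).real (openConn z b) -
        (prodBernoulli (fun f : Sym2 (Fin n) => if f = s(q₁, q₂) then 1 else w f)).real (openConn j b)) +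
      u * v * ((prodBernoulli (fun f : Sym2 (Fin n) => if f = s(p₁, p₂) then 1 else if f = s(q₁, q₂) then 1 else w f)).real (openConn z b) -
        (prodBernoulli (fun f : Sym2 (Fin n) => if f = s(p₁, p₂) then 1 else if f = s(q₁, q₂) then 1 else w f)).real (openConn j b))) :
    0 ≤ u * (1 - v) * ((prodBernoulli (fun f : Sym2 (Fin n) => if f = s(p₁, p₂) then 1 else w f)).real (openConn p₁ b) -
          (prodBernoulli (fun f : Sym2 (Fin n) => if f = s(p₁, p₂) then 1 else w f)).real (openConn j b)) +
      (1 - u) * v * ((prodBernoulli (fun f : Sym2 (Fin n) => if f = s(q₁, q₂) then 1 else w f)).real (openConn q₁ b) -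
          (prodBernoulli (fun f : Sym2 (Fin n) => if f = s(q₁, q₂) then 1 else w f)).real (openConn j b)) +
      u * v * ((prodBernoulli (fun f : Sym2 (Fin n) => if f = s(q₁, p₁) then 1 else
                  if f = s(p₁, p₂) then 1 else if f = s(q₁, q₂) then 1 else w f)).real (openConn p₁ b) -
          (prodBernoulli (fun f : Sym2 (Fin n) => if f = s(q₁, p₁) then 1 else
                  if f = s(p₁, p₂) then 1 else if f = s(q₁, q₂) then 1 else w f)).real (openConn j b)) :=
  twoFormalUnits_core w p₁ p₂ q₁ q₂ j b hp hq hpq hu0 hu1 hv0 hv1 hMP hMQ hrow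
    ((goodPort_exists w p₁ p₂ q₁ q₂ b hp hq).elim (fun h => Or.inr (Or.inr (Or.inl h)))
      (fun h => Or.inr (Or.inr (Or.inr h))))

end UpsetExchange

end

end Summit.CriticalPhenomena.PercolationContinuityZ3.Theorems
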